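import Summits.RiemannHypothesis.RiemannHypothesis.Theorems.SigmaLRungW0
import Summits.RiemannHypothesis.RiemannHypothesis.Theses.HardyZLehmerSplit

/-!
BC5 rung for `SigmaL` (stmt-RiemannHypothesis-24253, route HardyZLehmerSplit) — gen-2 CONFORMANCE + AXIOM AUDIT
(tribunal-w `rh-trib-w-sigmaL-1` g2). RH is NOT proved. This file only re-states by name what gen 1 landed
(p728249 `SigmaLCert.stub_onLine_W0`, p729465 `SigmaLRung.SigmaL_rung_W0`) and prints axiom closures.
-/

open Summit.RiemannHypothesis.RiemannHypothesis

namespace H21BC5Audit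

/-- The rung, by name, at the registered stub's exact signature (conformance). -/
theorem SigmaL_rung : ∀ t : ℝ, 3000175332820 < t → t < 3000175332830 →
    (IsLocalMin Literature.NumberTheory.LFunctions.hardyZ t → Literature.NumberTheory.LFunctions.hardyZ t ≤ 0) ∧
    (IsLocalMax Literature.NumberTheory.LFunctions.hardyZ t → 0 ≤ Literature.NumberTheory.LFunctions.hardyZ t) :=
  Theorems.SigmaLRung.SigmaL_rung_W0

/-- The rung is an INSTANCE of the crux (informational: `SigmaL → rung`; the converse is of course not claimed). -/
theorem rung_of_SigmaL (h : Theses.HardyZLehmerSplit.SigmaL) : ∀ t : ℝ, 3000175332820 < t → t < 3000175332830 →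
    (IsLocalMin Literature.NumberTheory.LFunctions.hardyZ t → Literature.NumberTheory.LFunctions.hardyZ t ≤ 0) ∧
    (IsLocalMax Literature.NumberTheory.LFunctions.hardyZ t → 0 ≤ Literature.NumberTheory.LFunctions.hardyZ t) := by
  intro t h1 _
  unfold Theses.HardyZLehmerSplit.SigmaL at h
  exact h t (by linarith)

/-- The RH-free REDUCTION used by the rung, as a clean conditional (no computation inside): zeros on the line in the
padded window ⟹ Σ_L on the window. -/
theorem rung_of_onLine
    (hline : ∀ s : ℂ, riemannZeta s = 0 → (3000175332819 : ℝ) < s.im → s.im < 3000175332840 → s.re = 1 / 2) :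
    ∀ t : ℝ, 3000175332820 < t → t < 3000175332830 →
    (IsLocalMin Literature.NumberTheory.LFunctions.hardyZ t → Literature.NumberTheory.LFunctions.hardyZ t ≤ 0) ∧
    (IsLocalMax Literature.NumberTheory.LFunctions.hardyZ t → 0 ≤ Literature.NumberTheory.LFunctions.hardyZ t) :=
  Theorems.SigmaLRung.noViolationOn_of_onLine (A' := 3000175332819) (B' := 3000175332840)
    (by norm_num) (by norm_num) (by norm_num) hline

#print axioms Summit.RiemannHypothesis.RiemannHypothesis.Theorems.SigmaLRung.SigmaL_rung_W0
#print axioms Summit.RiemannHypothesis.RiemannHypothesis.Theorems.SigmaLCert.stub_onLine_W0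
#print axioms Summit.RiemannHypothesis.RiemannHypothesis.Theorems.SigmaLRung.noViolationOn_of_onLine
#print axioms Summit.RiemannHypothesis.RiemannHypothesis.Theorems.SigmaLRung.localIvic
#print axioms Summit.RiemannHypothesis.RiemannHypothesis.Theorems.SigmaLRung.zetaZeroCount_lt_add_eight
#print axioms H21BC5Audit.rung_of_onLine
#print axioms H21BC5Audit.rung_of_SigmaL

end H21BC5Audit
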